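import Summits.QuantumFields.YangMills.Theorems.BalabanUVNodesN15KingModelAnalyticBlockCovPoles
import HarnessLib

/-!
# BalabanUVNodes ∕ N15 — THE KING-MODEL RUNG (PART Ϫ-k): NE2's UNIT LAYER IS COVARIANT UNDER THE COMPLEXIFIED GAUGE GROUP — for every pointwise-invertible (not necessarily unitary) gauge
# transformation `g : T_η → GL(n)` acting two-sidedly (`(g·U)(x,μ) = g(x)U(x,μ)g(x+e_μ)⁻¹`, `(g·V)(x,μ) = g(x+e_μ)V(x,μ)g(x)⁻¹`, PART Ϛ-h): the transports conjugate
# (`(g·U)(Γ_{y,x}) = g(y₀)U(Γ)g(x)⁻¹`), Bałaban's block maps conjugate (`Q(g·U) = D_{g∘c}Q(U)D_g⁻¹`, `Q♯_K(g·V) = D_gQ♯_K(V)D_{g∘c}⁻¹`, `c` = the block corners), hence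
# ★★★ `A(g·U,g·V) = D_gA(U,V)D_g⁻¹`, ★★★★ `Δ_eff(g·U,g·V) = D_{g∘c}Δ_eff(U,V)D_{g∘c}⁻¹`, ★★★★ `C(g·U,g·V) = D_{g∘c}C(U,V)D_{g∘c}⁻¹`; print's slice is preserved (`(g·U)⁻¹ = g·(U⁻¹)`), invertibility and
# determinants are invariant — ★★★★ THE POLE SET OF NE2's UNIT LAYER IS A UNION OF ORBITS OF THE COMPLEXIFIED GAUGE GROUP; for unitary `g` every norm in PART Ϫ is preserved
# (Track A, DAG node N15 = NE2; FAN-OUT v1.1 §N15 s3 «KING-MODEL RUNG … + what the curved case adds»; count-neutral)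

HONEST FRAMING.  Count-neutral (cell `pub-ymgap`, seat `pub-ymgap-dag-n15-e` g52; `--supports stmt-QuantumFields-27247 --as helper` = K3ᴬ, KEY MAP v3).  King's one-level comparison model;
pure algebra at every two-sided complex field (any `𝕜`, any tree contour system, any volume); the unitary statements use the C⋆-norm identities for unitary factors.  The gauge acts on block
fields through the CORNER GAUGE `g∘c` ([B9] (3.32)).  NOT Bałaban's multi-level objects; NOT a node discharge (N15 of record untouched); nothing continuum ∕ ℝ⁴ ∕ OS ∕ Clay.

THE RESULTS (`g` pointwise invertible unless said unitary; `D_h = kingGaugeMat`):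
* §1 `kingGaugeMat_mul_mul_apply` (entries of `D_G·Q·D_H` for rectangular `Q`), ★★ `treeHol_cxGaugeFwd` (`(g·U)(Γ_{y,x_j}) = g(y₀)U(Γ)g(x_j)⁻¹`), ★★ `treeHolRev_cxGaugeBwd` (`= g(x_j)V(Γ)g(y₀)⁻¹`),
  ★★★ **`covQ_cxGaugeFwd`** (`Q(g·U) = D_{g∘c}Q(U)D_{g⁻¹}`), ★★★ **`cxQadj_cxGaugeBwd`** (`Q♯(g·V) = D_gQ♯(V)D_{(g∘c)⁻¹}`), `cxKingQadj_cxGaugeBwd`.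
* §2 ★★★ **`cxFullOp_cxGauge`** (`A(g·U,g·V) = D_gA(U,V)D_{g⁻¹}`), `conj_inv_eq` (`(PXP′)⁻¹ = PX⁻¹P′` for `P′P = 1 = PP′`), ★★★ `cxSandwich_cxGauge`, ★★★★ **`cxEffLap_cxGauge`**, ★★★★ **`cxBlockCov_cxGauge`**,
  ★★ `inv_cxGaugeFwd` (print's slice is preserved: `(g·U)⁻¹ = g·(U⁻¹)` bondwise), ★★★★ **`cxBlockCov_print_cxGauge`** (`C(g·U,(g·U)⁻¹) = D_{g∘c}C(U,U⁻¹)D_{(g∘c)⁻¹}`).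
* §3 INVARIANTS: ★★★ `isUnit_cxEffLap_cxGauge_iff`, ★★★ `det_cxEffLap_cxGauge`, `det_cxBlockCov_cxGauge`, ★★★★ **`pole_set_gauge_invariant`** (`Δ_eff(g·U,(g·U)⁻¹)` singular ↔ `Δ_eff(U,U⁻¹)` singular).
* §4 UNITARY `g`: `blk_cxBlockCov_cxGauge` (`blk C(g·U,g·V) y y′ = g(c_y)·blk C(U,V) y y′·g(c_{y′})⁻¹`), ★★★ **`norm_blk_cxBlockCov_cxGauge`** (block norms preserved), ★★★ `l2_opNorm_cxBlockCov_cxGauge` (operator norm preserved),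
  ★★ `norm_cxGaugeFwd_sub` (`‖(g·U)_b − (g·U₀)_b‖ = ‖U_b − U₀_b‖` — polydiscs map to polydiscs), ★★★ **`king_blockCov_window_gauge_covariant`** (the window data transport along unitary gauge orbits).
PRIOR TREE ART (by name): Ϛ-h (`cxGaugeFwd`, `cxGaugeBwd`, `cxLapF_gauge`, `kingGaugeMat_mul`, `kingGaugeMat_mul_inv`, `kingGaugeMat_inv_mul`, `kingGaugeMat_inv_eq`, `isUnit_kingGaugeMat`, `blk_kingGaugeMat_mul_mul`, `norm_cxGaugeFwd_of_unitary`),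
Ͱ-a (`kingGaugeMat`, `kingGaugeMat_mem_unitaryGroup`), Ϥ-c (`cornerGauge`, `covQ_kingGaugeAct` — the unitary case), Ϥ-b (`treeHol_kingGaugeAct`, `site_eq_parent_add_unitVec`, `BlockTree.induction`), Ϩ-a (`treeHolRev`, `cxQadj_apply_site`,
`cxFullOp`), Ϩ-l (`cxKingQadj`, `cxEffLap`), Ϫ-a (`cxBlockCov`), Mathlib (`Matrix.det_conj`, `Matrix.mul_inv_rev`, `Matrix.nonsing_inv_nonsing_inv`, `CStarRing.norm_mem_unitary_mul`, `CStarRing.norm_mul_mem_unitary`).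
Dedup (rg at filing): basename 0 files; needles `treeHol_cxGaugeFwd|covQ_cxGaugeFwd|cxBlockCov_cxGauge|pole_set_gauge_invariant` 0 tree files.  Locators: [Balaban1985BackgroundPropagators] (3.28) p.395, (3.32) p.395, (3.34) p.396,
p.398 l.19, §3.B p.399 l.37–40, Thm 3.4 p.400; [King1986] (2.13)–(2.14) p.653, (4.44) p.675.  0 `sorry`, 0 `def`.
-/

noncomputable section
open scoped BigOperators ComplexConjugate ComplexOrder Matrix.Norms.L2Operator
open Finset Matrix

namespace Summit.QuantumFields.YangMills.BalabanUVNodes.N15KingModelRung.Analytic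

open Literature.MathematicalPhysics.QuantumFieldTheory.LatticeDiamagneticInequality (blk)
open Literature.MathematicalPhysics.QuantumFieldTheory.Balaban1983to89.B5Prop11Plancherel (Tor fine unitVec)
open Literature.MathematicalPhysics.QuantumFieldTheory.King1986.Torus (site blockOf blockOf_site blockEquiv blockEquiv_apply tdistT)
open Summit.QuantumFields.YangMills.BalabanUVNodes.N15KingModelRung.Covariant
  (kingGaugeMat kingGaugeMat_mem_unitaryGroup cxGaugeFwd cxGaugeBwd cxLapF_gauge kingGaugeMat_mul kingGaugeMat_mul_inv kingGaugeMat_inv_mul kingGaugeMat_inv_eq isUnit_kingGaugeMat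
    blk_kingGaugeMat_mul_mul norm_cxGaugeFwd_of_unitary)
open Summit.QuantumFields.YangMills.BalabanUVNodes.N15KingModelRung.CovariantBlock
  (BlockTree treeHol treeHol_root treeHol_of_ne_root site_eq_parent_add_unitVec covQ covQ_apply_site cornerGauge)
open Summit.QuantumFields.YangMills.BalabanUVNodes.N15KingModelRung.CombesThomas (ctRate)

variable {d : ℕ} {L : ℕ} [NeZero L] (T : BlockTree d L) (M : Fin (d + 1) → ℕ) [hM : ∀ μ, NeZero (M μ)]
variable {𝕜 : Type*} [RCLike 𝕜] {n : Type*} [Fintype n] [DecidableEq n]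

/-! ## §1 Transports and block maps under the complexified gauge group -/

section BlockMaps

omit [NeZero L] hM [DecidableEq n] in
/-- ENTRIES OF A TWO-SIDED BLOCK-DIAGONAL CONJUGATE OF A RECTANGULAR MATRIX: `(D_G·Q·D_H)((y,i),(x,k)) = Σ_{i′,k′} G(y)_{ii′}Q((y,i′),(x,k′))H(x)_{k′k}`. [folklore] -/
theorem kingGaugeMat_mul_mul_apply {K₁ K₂ : Fin (d + 1) → ℕ} [∀ μ, NeZero (K₁ μ)] [∀ μ, NeZero (K₂ μ)] (G : Tor K₁ → Matrix n n 𝕜) (Q : Matrix (Tor K₁ × n) (Tor K₂ × n) 𝕜) (H : Tor K₂ → Matrix n n 𝕜)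
    (y : Tor K₁) (i : n) (x : Tor K₂) (k : n) :
    (kingGaugeMat K₁ G * Q * kingGaugeMat K₂ H) (y, i) (x, k) = ∑ i', ∑ k', G y i i' * Q (y, i') (x, k') * H x k' k := by
  rw [Matrix.mul_apply, Fintype.sum_prod_type, Finset.sum_eq_single x]
  · rw [Finset.sum_comm]
    refine Finset.sum_congr rfl fun k' _ => ?_
    rw [Matrix.mul_apply, Fintype.sum_prod_type, Finset.sum_eq_single y]
    · simp only [kingGaugeMat, if_true, Finset.sum_mul]
    · intro y' _ hy'
      exact Finset.sum_eq_zero fun i' _ => by simp only [kingGaugeMat, if_neg (Ne.symm hy'), zero_mul]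
    · intro h; exact absurd (Finset.mem_univ y) h
  · intro x' _ hx'
    simp only [kingGaugeMat, if_neg hx', mul_zero, Finset.sum_const_zero]
  · intro h; exact absurd (Finset.mem_univ x) h

variable {g : Tor (fine L M) → Matrix n n 𝕜} (hg : ∀ x, IsUnit (g x))
include hg

omit hM in
/-- ★★ **THE TRANSPORT CONJUGATES UNDER THE COMPLEXIFIED GAUGE GROUP**: `(g·U)(Γ_{y,x_j}) = g(y₀)·U(Γ_{y,x_j})·g(x_j)⁻¹` (`y₀` = the block corner `site y root`) — the inner `g⁻¹g`'s cancel bond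
after bond. [cite: Balaban1985BackgroundPropagators, (3.32) p.395, (3.28) p.395, p.398 l.19] -/
theorem treeHol_cxGaugeFwd (U : Tor (fine L M) × Fin (d + 1) → Matrix n n 𝕜) (b : Tor M) :
    ∀ j, treeHol M T (cxGaugeFwd (fine L M) g U) b j = g (site L M b T.root) * treeHol M T U b j * (g (site L M b j))⁻¹ := by
  have hgg : ∀ x, (g x)⁻¹ * g x = 1 := fun x => Matrix.nonsing_inv_mul _ ((Matrix.isUnit_iff_isUnit_det _).mp (hg x))
  have hgg' : ∀ x, g x * (g x)⁻¹ = 1 := fun x => Matrix.mul_nonsing_inv _ ((Matrix.isUnit_iff_isUnit_det _).mp (hg x))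
  refine T.induction (P := fun j => treeHol M T (cxGaugeFwd (fine L M) g U) b j = g (site L M b T.root) * treeHol M T U b j * (g (site L M b j))⁻¹) ?_ fun j hj ih => ?_
  · rw [treeHol_root, treeHol_root, Matrix.mul_one, hgg']
  · rw [treeHol_of_ne_root T M _ b hj, treeHol_of_ne_root T M U b hj, ih]
    simp only [cxGaugeFwd]
    rw [← site_eq_parent_add_unitVec T M b hj]
    calc g (site L M b T.root) * treeHol M T U b (T.parent j) * (g (site L M b (T.parent j)))⁻¹ * (g (site L M b (T.parent j)) * U (site L M b (T.parent j), T.axis j) * (g (site L M b j))⁻¹)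
        = g (site L M b T.root) * treeHol M T U b (T.parent j) * ((g (site L M b (T.parent j)))⁻¹ * g (site L M b (T.parent j))) * U (site L M b (T.parent j), T.axis j) * (g (site L M b j))⁻¹ := by
          simp only [Matrix.mul_assoc]
      _ = g (site L M b T.root) * (treeHol M T U b (T.parent j) * U (site L M b (T.parent j), T.axis j)) * (g (site L M b j))⁻¹ := by
          rw [hgg, Matrix.mul_one]; simp only [Matrix.mul_assoc]

omit hM in
/-- ★★ **THE REVERSED TRANSPORT CONJUGATES THE OTHER WAY**: `(g·V)(Γ_{x_j,y}) = g(x_j)·V(Γ_{x_j,y})·g(y₀)⁻¹`. [cite: Balaban1985BackgroundPropagators, (3.32) p.395, §3.B p.399 l.37–40] -/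
theorem treeHolRev_cxGaugeBwd (V : Tor (fine L M) × Fin (d + 1) → Matrix n n 𝕜) (b : Tor M) :
    ∀ j, treeHolRev M T (cxGaugeBwd (fine L M) g V) b j = g (site L M b j) * treeHolRev M T V b j * (g (site L M b T.root))⁻¹ := by
  have hgg : ∀ x, (g x)⁻¹ * g x = 1 := fun x => Matrix.nonsing_inv_mul _ ((Matrix.isUnit_iff_isUnit_det _).mp (hg x))
  have hgg' : ∀ x, g x * (g x)⁻¹ = 1 := fun x => Matrix.mul_nonsing_inv _ ((Matrix.isUnit_iff_isUnit_det _).mp (hg x))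
  refine T.induction (P := fun j => treeHolRev M T (cxGaugeBwd (fine L M) g V) b j = g (site L M b j) * treeHolRev M T V b j * (g (site L M b T.root))⁻¹) ?_ fun j hj ih => ?_
  · rw [treeHolRev_root, treeHolRev_root, Matrix.mul_one, hgg']
  · rw [treeHolRev_of_ne_root T M _ b hj, treeHolRev_of_ne_root T M V b hj, ih]
    simp only [cxGaugeBwd]
    rw [← site_eq_parent_add_unitVec T M b hj]
    calc g (site L M b j) * V (site L M b (T.parent j), T.axis j) * (g (site L M b (T.parent j)))⁻¹ * (g (site L M b (T.parent j)) * treeHolRev M T V b (T.parent j) * (g (site L M b T.root))⁻¹)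
        = g (site L M b j) * V (site L M b (T.parent j), T.axis j) * ((g (site L M b (T.parent j)))⁻¹ * g (site L M b (T.parent j))) * treeHolRev M T V b (T.parent j) * (g (site L M b T.root))⁻¹ := by
          simp only [Matrix.mul_assoc]
      _ = g (site L M b j) * (V (site L M b (T.parent j), T.axis j) * treeHolRev M T V b (T.parent j)) * (g (site L M b T.root))⁻¹ := by
          rw [hgg, Matrix.mul_one]; simp only [Matrix.mul_assoc]

/-- ★★★ **BAŁABAN's COVARIANT BLOCK MEAN IS COVARIANT UNDER THE COMPLEXIFIED GAUGE GROUP**: `Q(g·U) = D_{g∘c}·Q(U)·D_{g⁻¹}` ([B9] (3.32) for `Gᶜ`-valued gauges; PART Ϥ-c's `covQ_kingGaugeAct` is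
the unitary case). [cite: Balaban1985BackgroundPropagators, (3.32) p.395, p.398 l.19, §3.B p.399 l.37–40] -/
theorem covQ_cxGaugeFwd (U : Tor (fine L M) × Fin (d + 1) → Matrix n n 𝕜) :
    covQ T M (cxGaugeFwd (fine L M) g U) = kingGaugeMat M (cornerGauge T M g) * covQ T M U * kingGaugeMat (fine L M) (fun x => (g x)⁻¹) := by
  ext ⟨y, i⟩ ⟨x, k⟩
  obtain ⟨⟨y', j⟩, rfl⟩ := (blockEquiv L M).surjective x
  rw [blockEquiv_apply, kingGaugeMat_mul_mul_apply, covQ_apply_site, treeHol_cxGaugeFwd T M hg U y j]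
  simp only [covQ_apply_site]
  by_cases hy : y = y'
  · subst hy
    simp only [if_true, cornerGauge, Matrix.mul_apply, Finset.mul_sum, Finset.sum_mul]
    rw [Finset.sum_comm]
    refine Finset.sum_congr rfl fun i' _ => Finset.sum_congr rfl fun k' _ => ?_
    ring
  · simp only [if_neg hy, mul_zero, zero_mul, Finset.sum_const_zero]

/-- ★★★ **THE CONTINUED `Q♯` IS COVARIANT THE OTHER WAY**: `Q♯(g·V) = D_g·Q♯(V)·D_{(g∘c)⁻¹}`. [cite: Balaban1985BackgroundPropagators, (3.32) p.395, §3.B p.399 l.37–40] -/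
theorem cxQadj_cxGaugeBwd (V : Tor (fine L M) × Fin (d + 1) → Matrix n n 𝕜) :
    cxQadj T M (cxGaugeBwd (fine L M) g V) = kingGaugeMat (fine L M) g * cxQadj T M V * kingGaugeMat M (fun y => (cornerGauge T M g y)⁻¹) := by
  ext ⟨x, k⟩ ⟨y, i⟩
  obtain ⟨⟨y', j⟩, rfl⟩ := (blockEquiv L M).surjective x
  rw [blockEquiv_apply, kingGaugeMat_mul_mul_apply, cxQadj_apply_site, treeHolRev_cxGaugeBwd T M hg V y j]
  simp only [cxQadj_apply_site]
  by_cases hy : y' = y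
  · subst hy
    simp only [if_true, cornerGauge, Matrix.mul_apply, Finset.mul_sum, Finset.sum_mul]
    rw [Finset.sum_comm]
    refine Finset.sum_congr rfl fun i' _ => Finset.sum_congr rfl fun k' _ => ?_
    ring
  · simp only [if_neg hy, mul_zero, zero_mul, Finset.sum_const_zero]

/-- `Q♯_K(g·V) = D_g·Q♯_K(V)·D_{(g∘c)⁻¹}`. [cite: King1986, (2.13) p.653; Balaban1985BackgroundPropagators, (3.32) p.395] -/
theorem cxKingQadj_cxGaugeBwd (V : Tor (fine L M) × Fin (d + 1) → Matrix n n 𝕜) :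
    cxKingQadj T M (cxGaugeBwd (fine L M) g V) = kingGaugeMat (fine L M) g * cxKingQadj T M V * kingGaugeMat M (fun y => (cornerGauge T M g y)⁻¹) := by
  rw [cxKingQadj, cxQadj_cxGaugeBwd T M hg, cxKingQadj, Matrix.mul_smul, Matrix.smul_mul]

end BlockMaps

/-! ## §2 The operators conjugate -/

section Operators

variable {g : Tor (fine L M) → Matrix n n 𝕜} (hg : ∀ x, IsUnit (g x)) (a c m2 : ℝ) (U V : Tor (fine L M) × Fin (d + 1) → Matrix n n 𝕜)
include hg

omit hM in
/-- The corner gauge is pointwise invertible when `g` is. [folklore] -/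
theorem isUnit_cornerGauge (y : Tor M) : IsUnit (cornerGauge T M g y) := hg _

/-- ★★★ **THE FULL OPERATOR CONJUGATES**: `A(g·U, g·V) = D_g·A(U,V)·D_{g⁻¹}` (PART Ϛ-h's `cxLapF_gauge` plus the block term `Q♯(g·V)Q(g·U) = D_gQ♯(V)(D_{(g∘c)⁻¹}D_{g∘c})Q(U)D_{g⁻¹}`).
[cite: Balaban1985BackgroundPropagators, (3.34) p.396, p.398 l.19, §3.B p.399 l.37–40] -/
theorem cxFullOp_cxGauge :
    cxFullOp T M a c m2 (cxGaugeFwd (fine L M) g U) (cxGaugeBwd (fine L M) g V) = kingGaugeMat (fine L M) g * cxFullOp T M a c m2 U V * kingGaugeMat (fine L M) (fun x => (g x)⁻¹) := by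
  have hcc : kingGaugeMat M (fun y => (cornerGauge T M g y)⁻¹) * kingGaugeMat M (cornerGauge T M g) = 1 := kingGaugeMat_inv_mul M (isUnit_cornerGauge T M hg)
  rw [cxFullOp, cxFullOp, cxLapF_gauge (fine L M) c m2 hg, cxQadj_cxGaugeBwd T M hg, covQ_cxGaugeFwd T M hg, Matrix.mul_add, Matrix.add_mul, Matrix.mul_smul, Matrix.smul_mul]
  congr 1
  congr 1
  simp only [Matrix.mul_assoc]
  rw [← Matrix.mul_assoc (kingGaugeMat M fun y => (cornerGauge T M g y)⁻¹), hcc, Matrix.one_mul]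

omit hM hg in
/-- `(P·X·P′)⁻¹ = P·X⁻¹·P′` whenever `P′P = 1 = PP′` (for ANY square `X`: both sides vanish when `X` is singular). [folklore] -/
theorem conj_inv_eq {ι : Type*} [Fintype ι] [DecidableEq ι] {P P' : Matrix ι ι 𝕜} (h1 : P' * P = 1) (h2 : P * P' = 1) (X : Matrix ι ι 𝕜) : (P * X * P')⁻¹ = P * X⁻¹ * P' := by
  by_cases hX : IsUnit X.det
  · refine Matrix.inv_eq_right_inv ?_
    calc P * X * P' * (P * X⁻¹ * P') = P * X * (P' * P) * X⁻¹ * P' := by simp only [Matrix.mul_assoc]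
      _ = 1 := by rw [h1, Matrix.mul_one, Matrix.mul_assoc P X, Matrix.mul_nonsing_inv _ hX, Matrix.mul_one, h2]
  · have hP : IsUnit P := IsUnit.of_mul_eq_one _ h2
    have hdet : ¬ IsUnit (P * X * P').det := by
      have hP' : P' = P⁻¹ := (Matrix.inv_eq_right_inv h2).symm
      rw [hP', Matrix.det_conj hP]; exact hX
    rw [Matrix.nonsing_inv_apply_not_isUnit _ hX, Matrix.nonsing_inv_apply_not_isUnit _ hdet, Matrix.mul_zero, Matrix.zero_mul]

/-- ★★★ **THE CONTINUED SANDWICH CONJUGATES BY THE CORNER GAUGE**: `Q(g·U)A(g·U,g·V)⁻¹Q♯_K(g·V) = D_{g∘c}·Q(U)A(U,V)⁻¹Q♯_K(V)·D_{(g∘c)⁻¹}`. [cite: King1986, (2.14) p.653; Balaban1985BackgroundPropagators, (3.32) p.395, (3.34) p.396] -/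
theorem cxSandwich_cxGauge :
    covQ T M (cxGaugeFwd (fine L M) g U) * (cxFullOp T M a c m2 (cxGaugeFwd (fine L M) g U) (cxGaugeBwd (fine L M) g V))⁻¹ * cxKingQadj T M (cxGaugeBwd (fine L M) g V)
      = kingGaugeMat M (cornerGauge T M g) * (covQ T M U * (cxFullOp T M a c m2 U V)⁻¹ * cxKingQadj T M V) * kingGaugeMat M (fun y => (cornerGauge T M g y)⁻¹) := by
  have h1 : kingGaugeMat (fine L M) (fun x => (g x)⁻¹) * kingGaugeMat (fine L M) g = 1 := kingGaugeMat_inv_mul (fine L M) hg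
  have h2 : kingGaugeMat (fine L M) g * kingGaugeMat (fine L M) (fun x => (g x)⁻¹) = 1 := kingGaugeMat_mul_inv (fine L M) hg
  rw [cxFullOp_cxGauge T M hg, conj_inv_eq h1 h2, covQ_cxGaugeFwd T M hg, cxKingQadj_cxGaugeBwd T M hg]
  simp only [Matrix.mul_assoc]
  rw [← Matrix.mul_assoc (kingGaugeMat (fine L M) fun x => (g x)⁻¹), h1, Matrix.one_mul, ← Matrix.mul_assoc (kingGaugeMat (fine L M) fun x => (g x)⁻¹), h1, Matrix.one_mul]

/-- ★★★★ **KING's CONTINUED EFFECTIVE LAPLACIAN IS GAUGE COVARIANT UNDER THE COMPLEXIFIED GAUGE GROUP**: `Δ_eff(g·U,g·V) = D_{g∘c}·Δ_eff(U,V)·D_{(g∘c)⁻¹}`.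
[cite: King1986, (2.14) p.653; Balaban1985BackgroundPropagators, (3.32) p.395, (3.34) p.396, §3.B p.399 l.37–40] -/
theorem cxEffLap_cxGauge :
    cxEffLap T M a c m2 (cxGaugeFwd (fine L M) g U) (cxGaugeBwd (fine L M) g V) = kingGaugeMat M (cornerGauge T M g) * cxEffLap T M a c m2 U V * kingGaugeMat M (fun y => (cornerGauge T M g y)⁻¹) := by
  have hcc : kingGaugeMat M (cornerGauge T M g) * kingGaugeMat M (fun y => (cornerGauge T M g y)⁻¹) = 1 := kingGaugeMat_mul_inv M (isUnit_cornerGauge T M hg)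
  rw [cxEffLap, cxEffLap, cxSandwich_cxGauge T M hg, Matrix.mul_sub, Matrix.sub_mul, Matrix.mul_smul, Matrix.smul_mul, Matrix.mul_smul, Matrix.smul_mul, Matrix.mul_one, hcc]

/-- ★★★★ **NE2's CONTINUED UNIT LAYER IS GAUGE COVARIANT UNDER THE COMPLEXIFIED GAUGE GROUP**: `C(g·U,g·V) = D_{g∘c}·C(U,V)·D_{(g∘c)⁻¹}`. [cite: King1986, (2.14) p.653, (4.44) p.675; Balaban1985BackgroundPropagators, (3.32) p.395] -/
theorem cxBlockCov_cxGauge :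
    cxBlockCov T M a c m2 (cxGaugeFwd (fine L M) g U) (cxGaugeBwd (fine L M) g V) = kingGaugeMat M (cornerGauge T M g) * cxBlockCov T M a c m2 U V * kingGaugeMat M (fun y => (cornerGauge T M g y)⁻¹) := by
  have hcc : kingGaugeMat M (cornerGauge T M g) * kingGaugeMat M (fun y => (cornerGauge T M g y)⁻¹) = 1 := kingGaugeMat_mul_inv M (isUnit_cornerGauge T M hg)
  rw [cxBlockCov, cxBlockCov, cxSandwich_cxGauge T M hg 0 c m2, Matrix.mul_add, Matrix.add_mul, Matrix.mul_smul, Matrix.smul_mul, Matrix.mul_one, hcc]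

omit [NeZero L] hM in
/-- ★★ **PRINT's SLICE IS PRESERVED**: `((g·U)_b)⁻¹ = (g·(U⁻¹))_b` bondwise (`(g(x)U_bg(x+e)⁻¹)⁻¹ = g(x+e)U_b⁻¹g(x)⁻¹`). [cite: Balaban1985BackgroundPropagators, §3.B p.399 l.37–40] -/
theorem inv_cxGaugeFwd (U : Tor (fine L M) × Fin (d + 1) → Matrix n n 𝕜) :
    (fun bd => (cxGaugeFwd (fine L M) g U bd)⁻¹) = cxGaugeBwd (fine L M) g (fun bd => (U bd)⁻¹) := by
  funext bd
  simp only [cxGaugeFwd, cxGaugeBwd]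
  rw [Matrix.mul_inv_rev, Matrix.mul_inv_rev, Matrix.nonsing_inv_nonsing_inv _ ((Matrix.isUnit_iff_isUnit_det _).mp (hg _)), Matrix.mul_assoc]

/-- ★★★★ **ON PRINT's SLICE**: `C(g·U, (g·U)⁻¹) = D_{g∘c}·C(U,U⁻¹)·D_{(g∘c)⁻¹}` for every pointwise-invertible complex gauge transformation `g`. [cite: King1986, (2.14) p.653; Balaban1985BackgroundPropagators, (3.32) p.395, §3.B p.399 l.37–40] -/
theorem cxBlockCov_print_cxGauge :
    cxBlockCov T M a c m2 (cxGaugeFwd (fine L M) g U) (fun bd => (cxGaugeFwd (fine L M) g U bd)⁻¹)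
      = kingGaugeMat M (cornerGauge T M g) * cxBlockCov T M a c m2 U (fun bd => (U bd)⁻¹) * kingGaugeMat M (fun y => (cornerGauge T M g y)⁻¹) := by
  rw [inv_cxGaugeFwd M hg, cxBlockCov_cxGauge T M hg]

/-- The same for `Δ_eff` on print's slice. [cite: King1986, (2.14) p.653; Balaban1985BackgroundPropagators, (3.32) p.395] -/
theorem cxEffLap_print_cxGauge :
    cxEffLap T M a c m2 (cxGaugeFwd (fine L M) g U) (fun bd => (cxGaugeFwd (fine L M) g U bd)⁻¹)
      = kingGaugeMat M (cornerGauge T M g) * cxEffLap T M a c m2 U (fun bd => (U bd)⁻¹) * kingGaugeMat M (fun y => (cornerGauge T M g y)⁻¹) := by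
  rw [inv_cxGaugeFwd M hg, cxEffLap_cxGauge T M hg]

/-! ## §3 Invariants: invertibility, determinants, the pole set -/

/-- ★★★ **INVERTIBILITY OF `Δ_eff` IS GAUGE INVARIANT** under the complexified gauge group. [cite: King1986, (2.14) p.653; Balaban1985BackgroundPropagators, (3.32) p.395] -/
theorem isUnit_cxEffLap_cxGauge_iff :
    IsUnit (cxEffLap T M a c m2 (cxGaugeFwd (fine L M) g U) (cxGaugeBwd (fine L M) g V)) ↔ IsUnit (cxEffLap T M a c m2 U V) := by
  have hP : IsUnit (kingGaugeMat M (cornerGauge T M g)) := isUnit_kingGaugeMat M (isUnit_cornerGauge T M hg)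
  rw [cxEffLap_cxGauge T M hg, ← kingGaugeMat_inv_eq M (isUnit_cornerGauge T M hg), Matrix.isUnit_iff_isUnit_det, Matrix.det_conj hP, ← Matrix.isUnit_iff_isUnit_det]

/-- ★★★ **THE GAUSSIAN NORMALISATION IS GAUGE INVARIANT**: `det Δ_eff(g·U,g·V) = det Δ_eff(U,V)`. [cite: King1986, (2.14) p.653, (4.5) p.670; Balaban1985BackgroundPropagators, (3.32) p.395] -/
theorem det_cxEffLap_cxGauge : (cxEffLap T M a c m2 (cxGaugeFwd (fine L M) g U) (cxGaugeBwd (fine L M) g V)).det = (cxEffLap T M a c m2 U V).det := by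
  have hP : IsUnit (kingGaugeMat M (cornerGauge T M g)) := isUnit_kingGaugeMat M (isUnit_cornerGauge T M hg)
  rw [cxEffLap_cxGauge T M hg, ← kingGaugeMat_inv_eq M (isUnit_cornerGauge T M hg), Matrix.det_conj hP]

/-- `det C(g·U,g·V) = det C(U,V)`. [cite: King1986, (2.14) p.653; Balaban1985BackgroundPropagators, (3.32) p.395] -/
theorem det_cxBlockCov_cxGauge : (cxBlockCov T M a c m2 (cxGaugeFwd (fine L M) g U) (cxGaugeBwd (fine L M) g V)).det = (cxBlockCov T M a c m2 U V).det := by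
  have hP : IsUnit (kingGaugeMat M (cornerGauge T M g)) := isUnit_kingGaugeMat M (isUnit_cornerGauge T M hg)
  rw [cxBlockCov_cxGauge T M hg, ← kingGaugeMat_inv_eq M (isUnit_cornerGauge T M hg), Matrix.det_conj hP]

/-- ★★★★ **THE POLE SET OF NE2's UNIT LAYER IS A UNION OF ORBITS OF THE COMPLEXIFIED GAUGE GROUP**: `Δ_eff(g·U,(g·U)⁻¹)` is singular ↔ `Δ_eff(U,U⁻¹)` is singular, for every
pointwise-invertible `g`. [cite: King1986, (2.14) p.653; Balaban1985BackgroundPropagators, (3.32) p.395, §3.B p.399 l.37–40, Thm 3.4 p.400] -/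
theorem pole_set_gauge_invariant :
    ¬ IsUnit (cxEffLap T M a c m2 (cxGaugeFwd (fine L M) g U) (fun bd => (cxGaugeFwd (fine L M) g U bd)⁻¹)) ↔ ¬ IsUnit (cxEffLap T M a c m2 U (fun bd => (U bd)⁻¹)) := by
  rw [inv_cxGaugeFwd M hg, isUnit_cxEffLap_cxGauge_iff T M hg]

end Operators

/-! ## §4 Unitary gauges: every norm of the PART is preserved -/

section Unitary

variable {g : Tor (fine L M) → Matrix n n 𝕜} (hgu : ∀ x, g x ∈ Matrix.unitaryGroup n 𝕜) (a c m2 : ℝ) (U V : Tor (fine L M) × Fin (d + 1) → Matrix n n 𝕜)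
include hgu

omit [NeZero L] hM in
/-- Unitary gauges are pointwise invertible. [folklore] -/
theorem isUnit_of_unitary_gauge (x : Tor (fine L M)) : IsUnit (g x) := by
  have h1 : (g x)ᴴ * g x = 1 := by simpa only [star_eq_conjTranspose] using Matrix.mem_unitaryGroup_iff'.mp (hgu x)
  exact (Matrix.isUnit_iff_isUnit_det _).mpr (Matrix.isUnit_det_of_left_inverse h1)

omit [NeZero L] hM in
/-- For unitary `g`: `(g x)⁻¹ = (g x)ᴴ` is unitary. [folklore] -/
theorem inv_mem_unitaryGroup_of_unitary (x : Tor (fine L M)) : (g x)⁻¹ ∈ Matrix.unitaryGroup n 𝕜 := by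
  have h1 : (g x)ᴴ * g x = 1 := by simpa only [star_eq_conjTranspose] using Matrix.mem_unitaryGroup_iff'.mp (hgu x)
  rw [Matrix.inv_eq_left_inv h1]
  simpa only [star_eq_conjTranspose] using Unitary.star_mem (hgu x)

/-- THE BLOCKS OF THE CONJUGATED COVARIANCE: `blk C(g·U,g·V) y y′ = g(c_y)·blk C(U,V) y y′·g(c_{y′})⁻¹`. [cite: Balaban1985BackgroundPropagators, (3.32) p.395] -/
theorem blk_cxBlockCov_cxGauge (y y' : Tor M) :
    blk (cxBlockCov T M a c m2 (cxGaugeFwd (fine L M) g U) (cxGaugeBwd (fine L M) g V)) y y' = cornerGauge T M g y * blk (cxBlockCov T M a c m2 U V) y y' * (cornerGauge T M g y')⁻¹ := by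
  rw [cxBlockCov_cxGauge T M (isUnit_of_unitary_gauge M hgu) a c m2 U V, blk_kingGaugeMat_mul_mul]

/-- ★★★ **UNITARY GAUGES PRESERVE THE BLOCK NORMS OF NE2's UNIT LAYER**: `‖blk C(g·U,g·V) y y′‖ = ‖blk C(U,V) y y′‖` — every block-decay statement of PARTS Ϫ-b∕Ϫ-e transports along unitary
gauge orbits verbatim. [cite: Balaban1985BackgroundPropagators, (3.32) p.395, Thm 3.4 p.400] -/
theorem norm_blk_cxBlockCov_cxGauge (y y' : Tor M) :
    ‖blk (cxBlockCov T M a c m2 (cxGaugeFwd (fine L M) g U) (cxGaugeBwd (fine L M) g V)) y y'‖ = ‖blk (cxBlockCov T M a c m2 U V) y y'‖ := by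
  have h1 : (cornerGauge T M g y')⁻¹ ∈ Matrix.unitaryGroup n 𝕜 := inv_mem_unitaryGroup_of_unitary M hgu _
  have h2 : cornerGauge T M g y ∈ Matrix.unitaryGroup n 𝕜 := hgu _
  rw [blk_cxBlockCov_cxGauge T M hgu, CStarRing.norm_mul_mem_unitary _ h1, CStarRing.norm_mem_unitary_mul _ h2]

/-- ★★★ **UNITARY GAUGES PRESERVE THE OPERATOR NORM OF NE2's UNIT LAYER**: `‖C(g·U,g·V)‖ = ‖C(U,V)‖`. [cite: Balaban1985BackgroundPropagators, (3.32) p.395] -/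
theorem l2_opNorm_cxBlockCov_cxGauge : ‖cxBlockCov T M a c m2 (cxGaugeFwd (fine L M) g U) (cxGaugeBwd (fine L M) g V)‖ = ‖cxBlockCov T M a c m2 U V‖ := by
  have hc : ∀ y, cornerGauge T M g y ∈ Matrix.unitaryGroup n 𝕜 := fun y => hgu _
  have hD : kingGaugeMat M (cornerGauge T M g) ∈ Matrix.unitaryGroup (Tor M × n) 𝕜 := kingGaugeMat_mem_unitaryGroup M hc
  have hDi : kingGaugeMat M (fun y => (cornerGauge T M g y)⁻¹) ∈ Matrix.unitaryGroup (Tor M × n) 𝕜 :=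
    kingGaugeMat_mem_unitaryGroup M fun y => (show (cornerGauge T M g y)⁻¹ ∈ Matrix.unitaryGroup n 𝕜 from inv_mem_unitaryGroup_of_unitary M hgu _)
  rw [cxBlockCov_cxGauge T M (isUnit_of_unitary_gauge M hgu), CStarRing.norm_mul_mem_unitary _ hDi, CStarRing.norm_mem_unitary_mul _ hD]

omit [NeZero L] hM in
/-- ★★ **POLYDISCS MAP TO POLYDISCS**: `‖(g·U)_b − (g·U₀)_b‖ = ‖U_b − U₀_b‖` for unitary `g`. [cite: Balaban1985BackgroundPropagators, p.398 l.19, Thm 3.4 p.400] -/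
theorem norm_cxGaugeFwd_sub (U₀ : Tor (fine L M) × Fin (d + 1) → Matrix n n 𝕜) (bd : Tor (fine L M) × Fin (d + 1)) :
    ‖cxGaugeFwd (fine L M) g U bd - cxGaugeFwd (fine L M) g U₀ bd‖ = ‖U bd - U₀ bd‖ := by
  have e : cxGaugeFwd (fine L M) g U bd - cxGaugeFwd (fine L M) g U₀ bd = cxGaugeFwd (fine L M) g (U - U₀) bd := by
    simp only [cxGaugeFwd, Pi.sub_apply, Matrix.mul_sub, Matrix.sub_mul]
  rw [e, norm_cxGaugeFwd_of_unitary (fine L M) hgu]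
  rfl

omit [NeZero L] hM in
/-- Unitary gauges preserve unitarity of link fields. [folklore] -/
theorem cxGaugeFwd_mem_unitaryGroup {U₀ : Tor (fine L M) × Fin (d + 1) → Matrix n n 𝕜} (hU₀ : ∀ bd, U₀ bd ∈ Matrix.unitaryGroup n 𝕜) (bd : Tor (fine L M) × Fin (d + 1)) :
    cxGaugeFwd (fine L M) g U₀ bd ∈ Matrix.unitaryGroup n 𝕜 := by
  unfold cxGaugeFwd
  exact Submonoid.mul_mem _ (Submonoid.mul_mem _ (hgu _) (hU₀ bd)) (inv_mem_unitaryGroup_of_unitary M hgu _)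

/-- ★★★ **THE WINDOW DATA TRANSPORT ALONG UNITARY GAUGE ORBITS**: if `U` lies in the polydisc of radius `ε` around the unitary `U₀`, then `g·U` lies in the polydisc of radius `ε` around the unitary
`g·U₀`, and NE2's unit layer there is the conjugate `D_{g∘c}C(U,U⁻¹)D_{(g∘c)⁻¹}` with the SAME block norms — so every constant of PART Ϫ (windows, `a⁻¹+4e∕m²`, `(8∕m²)e³`, `covLip`, `β₁`, `Γ₁`) is
gauge invariant, as it must be since it depends on `(m²,a,d)` only. [cite: Balaban1985BackgroundPropagators, (3.32) p.395, (3.34) p.396, Thm 3.4 p.400; King1986, (2.14) p.653] -/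
theorem king_blockCov_window_gauge_covariant {U₀ : Tor (fine L M) × Fin (d + 1) → Matrix n n 𝕜} (hU₀ : ∀ bd, U₀ bd ∈ Matrix.unitaryGroup n 𝕜) {ε : ℝ} (hU : ∀ bd, ‖U bd - U₀ bd‖ ≤ ε) :
    (∀ bd, cxGaugeFwd (fine L M) g U₀ bd ∈ Matrix.unitaryGroup n 𝕜)
    ∧ (∀ bd, ‖cxGaugeFwd (fine L M) g U bd - cxGaugeFwd (fine L M) g U₀ bd‖ ≤ ε)
    ∧ cxBlockCov T M a c m2 (cxGaugeFwd (fine L M) g U) (fun bd => (cxGaugeFwd (fine L M) g U bd)⁻¹)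
        = kingGaugeMat M (cornerGauge T M g) * cxBlockCov T M a c m2 U (fun bd => (U bd)⁻¹) * kingGaugeMat M (fun y => (cornerGauge T M g y)⁻¹)
    ∧ (∀ y y', ‖blk (cxBlockCov T M a c m2 (cxGaugeFwd (fine L M) g U) (fun bd => (cxGaugeFwd (fine L M) g U bd)⁻¹)) y y'‖ = ‖blk (cxBlockCov T M a c m2 U (fun bd => (U bd)⁻¹)) y y'‖)
    ∧ (¬ IsUnit (cxEffLap T M a c m2 (cxGaugeFwd (fine L M) g U) (fun bd => (cxGaugeFwd (fine L M) g U bd)⁻¹)) ↔ ¬ IsUnit (cxEffLap T M a c m2 U (fun bd => (U bd)⁻¹))) := by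
  have hg := isUnit_of_unitary_gauge M hgu
  refine ⟨cxGaugeFwd_mem_unitaryGroup M hgu hU₀, fun bd => by rw [norm_cxGaugeFwd_sub M hgu]; exact hU bd, cxBlockCov_print_cxGauge T M hg a c m2 U, fun y y' => ?_,
    pole_set_gauge_invariant T M hg a c m2 U⟩
  rw [inv_cxGaugeFwd M hg, norm_blk_cxBlockCov_cxGauge T M hgu]

end Unitary

end Summit.QuantumFields.YangMills.BalabanUVNodes.N15KingModelRung.Analytic

end
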